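import Literature.Geometry.Lorentzian.TeukolskyJostRemainderBound
import Literature.Geometry.Lorentzian.TeukolskyNormalisedInfinityExists
import HarnessLib
import Literature.Uncategorized.InfinityJostRemainderPoly

/-!
# S6f · `stub_infinityJostRemainderPoly` — quantitative Jost remainder of the infinity-normalised solution
# (crux `PhaseMixingCapture.KappaExplicitWaveDecay`, stmt-FinalStateConjecture-10654, line `olver-dunster-uniform-reduction`)

Closing file for the registered stub S6f (skeleton v9.6; lead seat c5, proof by the wave-6 worker W6-B). For
`M > 0`, `ω_l > 0` there are `C_J`, `p` such that every classical solution `R_𝓘` of the scalar radial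
Teukolsky ODE normalised at `𝓘⁺` (Teixeira da Costa Def. 2.3) at an admissible frequency with `|ω| ≥ ω_l`
satisfies `‖√(r²+a²)R_𝓘(r) − c₀e^{i(ωr + 2Mω log r)}‖ ≤ C_J(1+Λ)(1+|ω|)^p/(|ω|r)` for `r ≥ C_J` and
`r ≥ C_J(1+Λ)/|ω|`, uniformly in `|a| < M` (`c₀` the solution's own unimodular constant). The v9.5 form
lacked `C_J ≤ r` and quantified radii below `r₊` for large `|ω|` (refuted in the evidence file
`work/stubs/S6f/stub_infinityJostRemainderPoly.lean`, `not_infinityJostRemainderPoly`); v9.6 registers the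
corrected statement, re-declared verbatim here. Proof: the Jost/Volterra step on the GIVEN solution
(`Literature.Analysis.ODE.jost_outgoing_remainder`, p166353: the incoming amplitude is killed by the energy
and flux identities), the far tortoise asymptotics `Kerr.abs_starTime_sub_le`,
`Kerr.IsTortoiseRadius.integral_abs_sepPotential_le` (p167203) and `Kerr.jost_remainder_le` (p167482).
-/

-- the doubled `FinalStateConjecture.FinalStateConjecture` path component trips dupNamespace
set_option linter.dupNamespace false

namespace Summit.FinalStateConjecture.FinalStateConjecture.Theorems.KappaExplicitWaveDecay.OlverDunsterUniformReduction

open Literature.Geometry.Lorentzian MeasureTheory Filter Set Complex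
open scoped Topology Manifold ENNReal

/-- **S6f · `stub_infinityJostRemainderPoly`** — for `M > 0`, `ω_l > 0` there are `C_J`, `p` (here
`p = 2`, `C_J = max(8M+1, 1/(Mω_l²)+1, 12+16M²)`) such that every infinity-normalised classical solution
`R_𝓘` at an admissible frequency with `|ω| ≥ ω_l` satisfies
`‖√(r²+a²)R_𝓘(r) − c₀e^{i(ωr + 2Mω log r)}‖ ≤ C_J(1+Λ)(1+|ω|)^p/(|ω|r)` for `r ≥ C_J`, `r ≥ C_J(1+Λ)/|ω|`,
uniformly in `|a| < M` (Jost/Volterra step on the given solution: `Kerr.jost_remainder_le`,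
`Literature.Analysis.ODE.jost_outgoing_remainder`; tortoise far asymptotics `Kerr.abs_starTime_sub_le`).
[cite: Costa2019, Definition 2.3] -/
theorem stub_infinityJostRemainderPoly : Literature.Uncategorized.InfinityJostRemainderPoly := by
  intro M hM ωl hωl
  set CJ : ℝ := max (8 * M + 1) (max (1 / (M * ωl ^ 2) + 1) (12 + 16 * M ^ 2)) with hCJ
  have h8 : 8 * M + 1 ≤ CJ := le_max_left _ _
  have hl : 1 / (M * ωl ^ 2) + 1 ≤ CJ := le_trans (le_max_left _ _) (le_max_right _ _)
  have h12 : 12 + 16 * M ^ 2 ≤ CJ := le_trans (le_max_right _ _) (le_max_right _ _)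
  have hCJ0 : 0 < CJ := by linarith
  refine ⟨CJ, 2, hCJ0, fun a hMa ω m Λ hadm hωl' RI hR hn ↦ ?_⟩
  have hω0 : 0 < |ω| := hωl.trans_le hωl'
  have hω : ω ≠ 0 := abs_pos.1 hω0
  have hΛ : 0 ≤ Λ := hadm.nonneg
  obtain ⟨c₀, hc₀, hb⟩ := Kerr.jost_remainder_le hM hMa hω hadm hR hn
  refine ⟨c₀, hc₀, fun r hr1 hr2 ↦ ?_⟩
  have hr0 : 0 < r := hCJ0.trans_le hr1
  have hthr : max (8 * M) (max (Real.sqrt (12 * Λ) / |ω|) (1 / (M * ω ^ 2))) < r := by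
    refine max_lt (by linarith) (max_lt ?_ ?_)
    · have hs : Real.sqrt (12 * Λ) ≤ 1 + 3 * Λ := by
        rw [Real.sqrt_le_left (by positivity)]
        nlinarith [sq_nonneg (1 - 3 * Λ)]
      have hlt : Real.sqrt (12 * Λ) < CJ * (1 + Λ) := by nlinarith
      calc Real.sqrt (12 * Λ) / |ω| < CJ * (1 + Λ) / |ω| := div_lt_div_of_pos_right hlt hω0
        _ ≤ r := hr2
    · have hsq : ωl ^ 2 ≤ ω ^ 2 := by
        rw [← sq_abs ω]; exact pow_le_pow_left₀ hωl.le hωl' 2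
      calc 1 / (M * ω ^ 2) ≤ 1 / (M * ωl ^ 2) :=
            one_div_le_one_div_of_le (by positivity) (mul_le_mul_of_nonneg_left hsq hM.le)
        _ < CJ := by linarith
        _ ≤ r := hr1
  calc ‖(Real.sqrt (r ^ 2 + a ^ 2) : ℂ) * RI r -
        c₀ * Complex.exp (Complex.I * ω * r + 2 * Complex.I * M * ω * Real.log r)‖
      ≤ 12 * (1 + Λ) / (|ω| * r) + 16 * M ^ 2 * |ω| / r := hb r hthr
    _ = (12 * (1 + Λ) + 16 * M ^ 2 * |ω| ^ 2) / (|ω| * r) := by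
        rw [div_add_div _ _ (by positivity) hr0.ne', div_eq_div_iff (by positivity) (by positivity)]
        ring
    _ ≤ CJ * (1 + Λ) * (1 + |ω|) ^ 2 / (|ω| * r) := by
        have h1 : (1 : ℝ) ≤ (1 + |ω|) ^ 2 := by nlinarith
        have h2 : |ω| ^ 2 ≤ (1 + Λ) * (1 + |ω|) ^ 2 := by nlinarith
        have hnum : 12 * (1 + Λ) + 16 * M ^ 2 * |ω| ^ 2 ≤ CJ * (1 + Λ) * (1 + |ω|) ^ 2 := by
          nlinarith [mul_le_mul_of_nonneg_right h12
            (by positivity : (0 : ℝ) ≤ (1 + Λ) * (1 + |ω|) ^ 2),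
            mul_nonneg (by positivity : (0 : ℝ) ≤ 12 * (1 + Λ)) (sub_nonneg.2 h1),
            mul_nonneg (by positivity : (0 : ℝ) ≤ 16 * M ^ 2) (sub_nonneg.2 h2)]
        exact div_le_div_of_nonneg_right hnum (by positivity)
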